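import Summits.CriticalPhenomena.PercolationContinuityZ3.Theorems.PercNearOneGluingNoHeavyLowerTailIncStarBridgeEvents
import HarnessLib

/-!
# The TWO-PORT branch lemma (H), I: the event dictionary across an environment bridge at the port

Support file for the Sahi programme (`--supports stmt-CriticalPhenomena-4575`, prover prim-sahi-p2 gen 21).  No definitions, no named
facts, no sorries; standard axioms.  Memo `run/shared/lean/prim/prim-sahi/prim-sahi-p2/gen21/THEOREM-H.md` §1 and `PROOF-E3.md` §31.

**The two-port branch lemma (H).**  For product Bernoulli percolation `P = prodBernoulli w` on the pairs of `Fin n` with root `s`, vertices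
`u` (the ROOTED port; `u = s` allowed), `v ≠ s` (the UNROOTED port) and targets `b, c`, put
`U_b = {s↔u} ∩ {s↔v}ᶜ ∩ {b↔v}`, `X₃ = {s↔c} ∪ {u↔c} ∪ {v↔c}`, `X₂ = {s↔c} ∪ {u↔c}`.  On every apex-forest
  `(H)(u,v;b,c):  P(U_b)·P(X₃) ≤ P(U_b ∩ X₃) + P(U_b ∩ X₂)`
(`…IncStarTwoPortBranchLemma`); `(u, b) = (s, v)` is the branch lemma (Br) of `…IncStarBranchLemma`.  It is proved by induction over the
forest, peeling an environment bridge `e = s(v, x')` AT THE PORT `v`; this file is the pointwise dictionary for that step.  `L ∌ s` is the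
side of `v` (`v ∈ L`, `x' ∉ L`, `u ∉ L`), `hω` says that no pair from `L` to `(L ∪ {s})ᶜ` is open in `ω` (true a.s. once `e` is pinned
to `0`), the near block is `insert s L`, the far block `Lᶜ`, and the block events are
`S^A_y = {s↔y in insert s L}`, `{y↔y' in insert s L}`, `S^B_y = {s↔y in Lᶜ}`, `{y↔y' in Lᶜ}`.  With `ω⁺ = insert e ω`:
* `twoPort_mem_U_near/far`, `twoPort_lift_U_near/far` — `U_b` before and after opening the bridge, for `b` near / far;
* `twoPort_mem_X3_near/far`, `twoPort_lift_X3_near/far` — `X₃` is `{c↔v in A} ∪ S^A_c` for `c` near (bridge open or not), and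
  `S^B_c ∪ {u↔c in B}` resp. `S^B_c ∪ {u↔c in B} ∪ {x'↔c in B}` for `c` far;
* `twoPort_X2_near/far`, `twoPort_lift_X2_near/far` — on `U_b`, `X₂` is `S^A_c` resp. `S^B_c ∪ {u↔c in B}`;
* `twoPort_real_AA`, `twoPort_real_AB` — the real arithmetic of the bridge step (cases AA, AB).
-/

noncomputable section

namespace Summit.CriticalPhenomena.PercolationContinuityZ3.Theorems

namespace IncStar

open MeasureTheory Set Literature.Probability.Percolation Literature.Probability.LatticeModels EdgeInduction
open scoped Classical

variable {n : ℕ}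

/-- `U_b` for a near target `b ∈ L`, bridge closed: `U_b = ({b↔v in A} ∖ S^A_v) ∩ S^B_u`. [this work] -/
theorem twoPort_mem_U_near (L : Set (Fin n)) {s u v : Fin n} (hsL : s ∉ L) (hvL : v ∈ L) (huL : u ∉ L)
    {ω : BondConfig (Fin n)} (hω : ∀ x y : Fin n, x ∈ L → y ∉ L → y ≠ s → s(x, y) ∉ ω) {b : Fin n} (hbL : b ∈ L) :
    ω ∈ openConn s u ∩ (openConn s v)ᶜ ∩ openConn b v ↔
      (ω ∈ openConnIn (insert s L) b v ∧ ω ∉ openConnIn (insert s L) s v) ∧ ω ∈ openConnIn Lᶜ s u := by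
  have hs1 : s ∈ insert s L := Set.mem_insert s L
  rw [Set.mem_inter_iff, Set.mem_inter_iff, Set.mem_compl_iff,
    bridge_conn_rr L hsL hω (show s ∈ Lᶜ from hsL) (show u ∈ Lᶜ from huL),
    bridge_conn_ll L hsL hω hs1 (Set.mem_insert_of_mem s hvL),
    bridge_conn_ll L hsL hω (Set.mem_insert_of_mem s hbL) (Set.mem_insert_of_mem s hvL)]
  tauto

/-- `U_b` for a near target `b ∈ L`, bridge `e = s(v,x')` open:
`ω⁺ ∈ U_b ↔ ({b↔v in A} ∖ S^A_v) ∩ (S^B_u ∖ S^B_{x'})`. [this work] -/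
theorem twoPort_lift_U_near (L : Set (Fin n)) {s u v x' : Fin n} (hsL : s ∉ L) (hvL : v ∈ L) (hxL : x' ∉ L) (huL : u ∉ L)
    {ω : BondConfig (Fin n)} (hω : ∀ x y : Fin n, x ∈ L → y ∉ L → y ≠ s → s(x, y) ∉ ω) {b : Fin n} (hbL : b ∈ L) :
    insert s(v, x') ω ∈ openConn s u ∩ (openConn s v)ᶜ ∩ openConn b v ↔
      (ω ∈ openConnIn (insert s L) b v ∧ ω ∉ openConnIn (insert s L) s v) ∧
        (ω ∈ openConnIn Lᶜ s u ∧ ω ∉ openConnIn Lᶜ s x') := by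
  have hs1 : s ∈ insert s L := Set.mem_insert s L
  have hb1 : b ∈ insert s L := Set.mem_insert_of_mem s hbL
  have hv1 : v ∈ insert s L := Set.mem_insert_of_mem s hvL
  have hvv : ω ∈ openConnIn (insert s L) v v := ⟨hv1, hv1, SimpleGraph.Reachable.refl _⟩
  rw [Set.mem_inter_iff, Set.mem_inter_iff, Set.mem_compl_iff, bridge_lift_far L hsL hvL hxL huL hω,
    bridge_lift_near L hsL hvL hxL hvL hω, insert_pair_mem_openConn_iff,
    bridge_conn_ll L hsL hω hb1 hv1, bridge_conn_lr L hsL hω hb1 (show x' ∈ Lᶜ from hxL),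
    bridge_conn_ll L hsL hω hv1 hv1, bridge_conn_rl L hsL hω (show x' ∈ Lᶜ from hxL) hv1]
  tauto

/-- `U_b` for a far target `b ∉ L`, bridge closed: impossible (`b↔v` would pass through the root). [this work] -/
theorem twoPort_mem_U_far (L : Set (Fin n)) {s u v : Fin n} (hsL : s ∉ L) (hvL : v ∈ L)
    {ω : BondConfig (Fin n)} (hω : ∀ x y : Fin n, x ∈ L → y ∉ L → y ≠ s → s(x, y) ∉ ω) {b : Fin n} (hbL : b ∉ L) :
    ω ∉ openConn s u ∩ (openConn s v)ᶜ ∩ openConn b v := by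
  have hv1 : v ∈ insert s L := Set.mem_insert_of_mem s hvL
  rw [Set.mem_inter_iff, Set.mem_inter_iff, Set.mem_compl_iff,
    bridge_conn_ll L hsL hω (Set.mem_insert s L) hv1, bridge_conn_rl L hsL hω (show b ∈ Lᶜ from hbL) hv1]
  tauto

/-- `U_b` for a far target `b ∉ L`, bridge open: `ω⁺ ∈ U_b ↔ (S^A_v)ᶜ ∩ (S^B_u ∖ S^B_{x'}) ∩ {b↔x' in B}`. [this work] -/
theorem twoPort_lift_U_far (L : Set (Fin n)) {s u v x' : Fin n} (hsL : s ∉ L) (hvL : v ∈ L) (hxL : x' ∉ L) (huL : u ∉ L)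
    {ω : BondConfig (Fin n)} (hω : ∀ x y : Fin n, x ∈ L → y ∉ L → y ≠ s → s(x, y) ∉ ω) {b : Fin n} (hbL : b ∉ L) :
    insert s(v, x') ω ∈ openConn s u ∩ (openConn s v)ᶜ ∩ openConn b v ↔
      ω ∉ openConnIn (insert s L) s v ∧
        ((ω ∈ openConnIn Lᶜ s u ∧ ω ∉ openConnIn Lᶜ s x') ∧ ω ∈ openConnIn Lᶜ b x') := by
  have hs1 : s ∈ insert s L := Set.mem_insert s L
  have hv1 : v ∈ insert s L := Set.mem_insert_of_mem s hvL
  rw [Set.mem_inter_iff, Set.mem_inter_iff, Set.mem_compl_iff, bridge_lift_far L hsL hvL hxL huL hω,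
    bridge_lift_near L hsL hvL hxL hvL hω, insert_pair_mem_openConn_iff,
    bridge_conn_rl L hsL hω (show b ∈ Lᶜ from hbL) hv1, bridge_conn_rr L hsL hω (show b ∈ Lᶜ from hbL) (show x' ∈ Lᶜ from hxL),
    bridge_conn_ll L hsL hω hv1 hv1, bridge_conn_rl L hsL hω (show x' ∈ Lᶜ from hxL) hv1]
  have hvv : ω ∈ openConnIn (insert s L) v v := ⟨hv1, hv1, SimpleGraph.Reachable.refl _⟩
  tauto

/-- `X₃` for a near target `c ∈ L`, bridge closed: `{c↔v in A} ∪ S^A_c`. [this work] -/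
theorem twoPort_mem_X3_near (L : Set (Fin n)) {s u v : Fin n} (hsL : s ∉ L) (hvL : v ∈ L) (huL : u ∉ L)
    {ω : BondConfig (Fin n)} (hω : ∀ x y : Fin n, x ∈ L → y ∉ L → y ≠ s → s(x, y) ∉ ω) {c : Fin n} (hcL : c ∈ L) :
    ω ∈ openConn s c ∪ openConn u c ∪ openConn v c ↔
      ω ∈ openConnIn (insert s L) s c ∨ ω ∈ openConnIn (insert s L) v c := by
  have hs1 : s ∈ insert s L := Set.mem_insert s L
  have hc1 : c ∈ insert s L := Set.mem_insert_of_mem s hcL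
  have hv1 : v ∈ insert s L := Set.mem_insert_of_mem s hvL
  rw [Set.mem_union, Set.mem_union, bridge_conn_ll L hsL hω hs1 hc1, bridge_conn_rl L hsL hω (show u ∈ Lᶜ from huL) hc1,
    bridge_conn_ll L hsL hω hv1 hc1]
  tauto

/-- `X₃` for a near target `c ∈ L`, bridge open: still `{c↔v in A} ∪ S^A_c`. [this work] -/
theorem twoPort_lift_X3_near (L : Set (Fin n)) {s u v x' : Fin n} (hsL : s ∉ L) (hvL : v ∈ L) (hxL : x' ∉ L) (huL : u ∉ L)
    {ω : BondConfig (Fin n)} (hω : ∀ x y : Fin n, x ∈ L → y ∉ L → y ≠ s → s(x, y) ∉ ω) {c : Fin n} (hcL : c ∈ L) :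
    insert s(v, x') ω ∈ openConn s c ∪ openConn u c ∪ openConn v c ↔
      ω ∈ openConnIn (insert s L) s c ∨ ω ∈ openConnIn (insert s L) v c := by
  have hs1 : s ∈ insert s L := Set.mem_insert s L
  have hc1 : c ∈ insert s L := Set.mem_insert_of_mem s hcL
  have hv1 : v ∈ insert s L := Set.mem_insert_of_mem s hvL
  have hx2 : x' ∈ Lᶜ := hxL
  have hu2 : u ∈ Lᶜ := huL
  rw [Set.mem_union, Set.mem_union, bridge_lift_near L hsL hvL hxL hcL hω, insert_pair_mem_openConn_iff,
    insert_pair_mem_openConn_iff, bridge_conn_rl L hsL hω hu2 hc1, bridge_conn_rl L hsL hω hu2 hv1,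
    bridge_conn_rr L hsL hω hu2 hx2, bridge_conn_ll L hsL hω hv1 hc1, bridge_conn_rl L hsL hω hx2 hc1,
    bridge_conn_ll L hsL hω hv1 hv1, bridge_conn_lr L hsL hω hv1 hx2]
  tauto

/-- `X₃` for a far target `c ∉ L`, bridge closed: `S^B_c ∪ {u↔c in B}`. [this work] -/
theorem twoPort_mem_X3_far (L : Set (Fin n)) {s u v : Fin n} (hsL : s ∉ L) (hvL : v ∈ L) (huL : u ∉ L)
    {ω : BondConfig (Fin n)} (hω : ∀ x y : Fin n, x ∈ L → y ∉ L → y ≠ s → s(x, y) ∉ ω) {c : Fin n} (hcL : c ∉ L) :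
    ω ∈ openConn s c ∪ openConn u c ∪ openConn v c ↔
      ω ∈ openConnIn Lᶜ s c ∨ ω ∈ openConnIn Lᶜ u c := by
  have hv1 : v ∈ insert s L := Set.mem_insert_of_mem s hvL
  have hc2 : c ∈ Lᶜ := hcL
  rw [Set.mem_union, Set.mem_union, bridge_conn_rr L hsL hω (show s ∈ Lᶜ from hsL) hc2,
    bridge_conn_rr L hsL hω (show u ∈ Lᶜ from huL) hc2, bridge_conn_lr L hsL hω hv1 hc2]
  tauto

/-- `X₃` for a far target `c ∉ L`, bridge open: `S^B_c ∪ {u↔c in B} ∪ {x'↔c in B}`. [this work] -/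
theorem twoPort_lift_X3_far (L : Set (Fin n)) {s u v x' : Fin n} (hsL : s ∉ L) (hvL : v ∈ L) (hxL : x' ∉ L) (huL : u ∉ L)
    {ω : BondConfig (Fin n)} (hω : ∀ x y : Fin n, x ∈ L → y ∉ L → y ≠ s → s(x, y) ∉ ω) {c : Fin n} (hcL : c ∉ L) :
    insert s(v, x') ω ∈ openConn s c ∪ openConn u c ∪ openConn v c ↔
      ω ∈ openConnIn Lᶜ s c ∨ ω ∈ openConnIn Lᶜ u c ∨ ω ∈ openConnIn Lᶜ x' c := by
  have hs1 : s ∈ insert s L := Set.mem_insert s L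
  have hv1 : v ∈ insert s L := Set.mem_insert_of_mem s hvL
  have hc2 : c ∈ Lᶜ := hcL
  have hx2 : x' ∈ Lᶜ := hxL
  have hu2 : u ∈ Lᶜ := huL
  rw [Set.mem_union, Set.mem_union, bridge_lift_far L hsL hvL hxL hcL hω, insert_pair_mem_openConn_iff,
    insert_pair_mem_openConn_iff, bridge_conn_rr L hsL hω hu2 hc2, bridge_conn_rl L hsL hω hu2 hv1,
    bridge_conn_rr L hsL hω hu2 hx2, bridge_conn_lr L hsL hω hv1 hc2, bridge_conn_rr L hsL hω hx2 hc2,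
    bridge_conn_ll L hsL hω hv1 hv1, bridge_conn_lr L hsL hω hv1 hx2]
  have hss : ω ∈ openConnIn Lᶜ s s := ⟨hsL, hsL, SimpleGraph.Reachable.refl _⟩
  have hvv : ω ∈ openConnIn (insert s L) v v := ⟨hv1, hv1, SimpleGraph.Reachable.refl _⟩
  tauto

/-- `X₂` on `U_b`, near target `c ∈ L`, bridge closed: `S^A_c`. [this work] -/
theorem twoPort_X2_near (L : Set (Fin n)) {s u : Fin n} (hsL : s ∉ L) (huL : u ∉ L)
    {ω : BondConfig (Fin n)} (hω : ∀ x y : Fin n, x ∈ L → y ∉ L → y ≠ s → s(x, y) ∉ ω) {c : Fin n} (hcL : c ∈ L) :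
    ω ∈ openConn s c ∪ openConn u c ↔ ω ∈ openConnIn (insert s L) s c := by
  have hs1 : s ∈ insert s L := Set.mem_insert s L
  have hc1 : c ∈ insert s L := Set.mem_insert_of_mem s hcL
  rw [Set.mem_union, bridge_conn_ll L hsL hω hs1 hc1, bridge_conn_rl L hsL hω (show u ∈ Lᶜ from huL) hc1]
  tauto

/-- `X₂` on `U_b`, near target `c ∈ L`, bridge open: `S^A_c`. [this work] -/
theorem twoPort_lift_X2_near (L : Set (Fin n)) {s u v x' : Fin n} (hsL : s ∉ L) (hvL : v ∈ L) (hxL : x' ∉ L) (huL : u ∉ L)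
    {ω : BondConfig (Fin n)} (hω : ∀ x y : Fin n, x ∈ L → y ∉ L → y ≠ s → s(x, y) ∉ ω) {b c : Fin n} (hcL : c ∈ L)
    (hU : insert s(v, x') ω ∈ openConn s u ∩ (openConn s v)ᶜ ∩ openConn b v) :
    insert s(v, x') ω ∈ openConn s c ∪ openConn u c ↔ ω ∈ openConnIn (insert s L) s c := by
  have hs1 : s ∈ insert s L := Set.mem_insert s L
  have hc1 : c ∈ insert s L := Set.mem_insert_of_mem s hcL
  have hv1 : v ∈ insert s L := Set.mem_insert_of_mem s hvL
  have hx2 : x' ∈ Lᶜ := hxL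
  have hu2 : u ∈ Lᶜ := huL
  -- the lifted `U_b` gives `¬ S^A_v`, `¬ S^B_{x'}`, `S^B_u`
  have hU' : ω ∉ openConnIn (insert s L) s v ∧ ω ∉ openConnIn Lᶜ s x' ∧ ω ∈ openConnIn Lᶜ s u := by
    have h1 := hU.1.1
    have h2 := hU.1.2
    rw [Set.mem_compl_iff, bridge_lift_near L hsL hvL hxL hvL hω] at h2
    rw [bridge_lift_far L hsL hvL hxL huL hω] at h1
    have hvv : ω ∈ openConnIn (insert s L) v v := ⟨hv1, hv1, SimpleGraph.Reachable.refl _⟩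
    refine ⟨fun h => h2 (Or.inl h), fun h => h2 (Or.inr ⟨h, hvv⟩), ?_⟩
    rcases h1 with h | ⟨h, _⟩
    · exact h
    · exact absurd (Or.inl h) h2
  obtain ⟨hnv, hnx, hsu⟩ := hU'
  have himp : ω ∈ openConnIn Lᶜ u x' → ω ∈ openConnIn Lᶜ s x' := fun h => PlanarDuality.openConnIn_trans hsu h
  rw [Set.mem_union, bridge_lift_near L hsL hvL hxL hcL hω, insert_pair_mem_openConn_iff,
    bridge_conn_rl L hsL hω hu2 hc1, bridge_conn_rl L hsL hω hu2 hv1, bridge_conn_rr L hsL hω hu2 hx2,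
    bridge_conn_ll L hsL hω hv1 hc1, bridge_conn_rl L hsL hω hx2 hc1]
  tauto

/-- `X₂` on `U_b`, far target `c ∉ L`, bridge closed: `S^B_c ∪ {u↔c in B}`. [this work] -/
theorem twoPort_X2_far (L : Set (Fin n)) {s u : Fin n} (hsL : s ∉ L) (huL : u ∉ L)
    {ω : BondConfig (Fin n)} (hω : ∀ x y : Fin n, x ∈ L → y ∉ L → y ≠ s → s(x, y) ∉ ω) {c : Fin n} (hcL : c ∉ L) :
    ω ∈ openConn s c ∪ openConn u c ↔ ω ∈ openConnIn Lᶜ s c ∨ ω ∈ openConnIn Lᶜ u c := by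
  have hc2 : c ∈ Lᶜ := hcL
  rw [Set.mem_union, bridge_conn_rr L hsL hω (show s ∈ Lᶜ from hsL) hc2, bridge_conn_rr L hsL hω (show u ∈ Lᶜ from huL) hc2]

/-- `X₂` on `U_b`, far target `c ∉ L`, bridge open: `S^B_c ∪ {u↔c in B}`. [this work] -/
theorem twoPort_lift_X2_far (L : Set (Fin n)) {s u v x' : Fin n} (hsL : s ∉ L) (hvL : v ∈ L) (hxL : x' ∉ L) (huL : u ∉ L)
    {ω : BondConfig (Fin n)} (hω : ∀ x y : Fin n, x ∈ L → y ∉ L → y ≠ s → s(x, y) ∉ ω) {b c : Fin n} (hcL : c ∉ L)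
    (hU : insert s(v, x') ω ∈ openConn s u ∩ (openConn s v)ᶜ ∩ openConn b v) :
    insert s(v, x') ω ∈ openConn s c ∪ openConn u c ↔ ω ∈ openConnIn Lᶜ s c ∨ ω ∈ openConnIn Lᶜ u c := by
  have hs1 : s ∈ insert s L := Set.mem_insert s L
  have hv1 : v ∈ insert s L := Set.mem_insert_of_mem s hvL
  have hc2 : c ∈ Lᶜ := hcL
  have hx2 : x' ∈ Lᶜ := hxL
  have hu2 : u ∈ Lᶜ := huL
  have hU' : ω ∉ openConnIn (insert s L) s v ∧ ω ∉ openConnIn Lᶜ s x' ∧ ω ∈ openConnIn Lᶜ s u := by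
    have h1 := hU.1.1
    have h2 := hU.1.2
    rw [Set.mem_compl_iff, bridge_lift_near L hsL hvL hxL hvL hω] at h2
    rw [bridge_lift_far L hsL hvL hxL huL hω] at h1
    have hvv : ω ∈ openConnIn (insert s L) v v := ⟨hv1, hv1, SimpleGraph.Reachable.refl _⟩
    refine ⟨fun h => h2 (Or.inl h), fun h => h2 (Or.inr ⟨h, hvv⟩), ?_⟩
    rcases h1 with h | ⟨h, _⟩
    · exact h
    · exact absurd (Or.inl h) h2
  obtain ⟨hnv, hnx, hsu⟩ := hU'
  have himp : ω ∈ openConnIn Lᶜ u x' → ω ∈ openConnIn Lᶜ s x' := fun h => PlanarDuality.openConnIn_trans hsu h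
  rw [Set.mem_union, bridge_lift_far L hsL hvL hxL hcL hω, insert_pair_mem_openConn_iff,
    bridge_conn_rr L hsL hω hu2 hc2, bridge_conn_rl L hsL hω hu2 hv1, bridge_conn_rr L hsL hω hu2 hx2,
    bridge_conn_lr L hsL hω hv1 hc2, bridge_conn_rr L hsL hω hx2 hc2]
  tauto


/-! ### Real arithmetic of the bridge step (`…IncStarTwoPortStepNear`) -/

/-- Real arithmetic of case AA: multiply the induction instance by `β = (1−p)a + pa′ ≥ 0`. [this work] -/
theorem twoPort_real_AA (p D Z DZ DS a a' : ℝ) (hp0 : 0 ≤ p) (hp1 : p ≤ 1) (ha : 0 ≤ a) (ha' : 0 ≤ a')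
    (IH : D * Z ≤ DZ + DS) :
    ((1 - p) * (D * a) + p * (D * a')) * ((1 - p) * Z + p * Z)
      ≤ ((1 - p) * (DZ * a) + p * (DZ * a')) + ((1 - p) * (DS * a) + p * (DS * a')) := by
  have hβ : 0 ≤ (1 - p) * a + p * a' := add_nonneg (mul_nonneg (by linarith) ha) (mul_nonneg hp0 ha')
  have key := mul_le_mul_of_nonneg_left IH hβ
  have e1 : ((1 - p) * (D * a) + p * (D * a')) * ((1 - p) * Z + p * Z) = ((1 - p) * a + p * a') * (D * Z) := by ring
  have e2 : ((1 - p) * (DZ * a) + p * (DZ * a')) + ((1 - p) * (DS * a) + p * (DS * a'))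
      = ((1 - p) * a + p * a') * (DZ + DS) := by ring
  rw [e1, e2]
  exact key

/-- Real arithmetic of case AB (PROOF-E3 §31 (b)): with `a = a′ + q`, the induction instance `a′X₁ ≤ L₁`, Harris `aX₀ ≤ L₀` and
`qN ≤ L₀`, and `X₀ ≤ X₁ ≤ X₀ + N`:  `((1−p)a + pa′)((1−p)X₀ + pX₁) ≤ (1−p)·2L₀ + p·L₁` (times `D ≥ 0`). [this work] -/
theorem twoPort_real_AB (p D a a' q L0 L1a L1b X0 X1 N : ℝ) (hp0 : 0 ≤ p) (hp1 : p ≤ 1) (hD : 0 ≤ D) (hq : 0 ≤ q)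
    (haq : a = a' + q) (IH : a' * X1 ≤ L1a + L1b) (h1 : a * X0 ≤ L0) (h2 : q * N ≤ L0) (h3 : X1 ≤ X0 + N) (hX : X0 ≤ X1) :
    ((1 - p) * (D * a) + p * (D * a')) * ((1 - p) * X0 + p * X1)
      ≤ ((1 - p) * (D * L0) + p * (D * L1a)) + ((1 - p) * (D * L0) + p * (D * L1b)) := by
  rw [← sub_nonneg]
  have key : ((1 - p) * (D * L0) + p * (D * L1a)) + ((1 - p) * (D * L0) + p * (D * L1b))
      - ((1 - p) * (D * a) + p * (D * a')) * ((1 - p) * X0 + p * X1)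
      = D * (p * (L1a + L1b - a' * X1) + (1 - p) * ((2 * L0 - a * X0) - p * ((a - a') * (X1 - X0)))) := by ring
  rw [key]
  have t1 : 0 ≤ L1a + L1b - a' * X1 := by linarith
  have t2 : q * (X1 - X0) ≤ L0 := by nlinarith
  have t3 : (a - a') * (X1 - X0) = q * (X1 - X0) := by rw [haq]; ring
  have t4 : 0 ≤ q * (X1 - X0) := mul_nonneg hq (by linarith)
  have t5 : p * (q * (X1 - X0)) ≤ q * (X1 - X0) := by nlinarith
  have t6 : 0 ≤ (2 * L0 - a * X0) - p * ((a - a') * (X1 - X0)) := by rw [t3]; linarith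
  exact mul_nonneg hD (add_nonneg (mul_nonneg hp0 t1) (mul_nonneg (by linarith) t6))

end IncStar

end Summit.CriticalPhenomena.PercolationContinuityZ3.Theorems
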